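import Literature.Analysis.FluidPDE.AdaptedBackwardKernel
import Literature.Analysis.FluidPDE.ClassicalSolutionRescale
import Literature.Analysis.FluidPDE.DirectionDissipation
import HarnessLib

/-!
# Time dilation of ancient data: from unit viscosity back to viscosity `ν`
# (route `AdaptedFrequency`, item `TangentFlowTransfer`, stmt-NavierStokesRegularity-10494)

Helper file (all results proved), companion of `AdaptedFrequencyTangentFlowTransferViscosity`
(which normalises the data of the item to unit viscosity). The blow-up limit of the normalised
zoomed sequence is an ancient flow `W` of unit viscosity with an adapted kernel `K` on `(−∞, 0)`
with pole `(0, 0)`; the conclusion of the item asks for viscosity `ν`. The time dilation by a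
factor `a > 0`, `u_a(s, x) = a u(a s, x)`, `p_a = a² p(a s, ·)`, `G_a(s, x) = G(a s, x)` (in the
tree's vocabulary `a • stPull a 1 0 0 u`, `stPull a 1 0 0 G`) maps viscosity `ν` to `a ν`,
preserves the time set `(−∞, 0)` and the pole `(0, x₀)`, and every ancient clause is covariant:

* `isAdaptedBackwardKernel_dilate`: the five kernel clauses on `Iio 0`, viscosity `ν ↦ a ν`;
* `gaussian_bounds_dilate`: Gaussian bounds about `(0, x₀)` with constants
  `(c₁ a^{-n/2}, c₂ a, C₁ a^{-n/2}, C₂ a)`;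
* `adaptedEnstrophy_dilate`, `adaptedFrequency_dilate`: `H_a(s) = a² H(a s)` and
  `Λ_a(s) = Λ(a s)` (pole time `0`), so positivity of `H` and constancy of `Λ` are preserved;
* `isClassicalNSSolutionOn_dilate_Iio`, `typeI_bound_dilate`: classical solutions on `(−∞, 0)`,
  viscosity `ν ↦ a ν`, and the Type-I bound with constant `C √a`.

With `a = ν` this takes the unit-viscosity tangent flow to the viscosity-`ν` conclusion of
`TangentFlowTransfer`.

References: T. Tao, Anal. PDE 6 (2013) = arXiv:1108.1165, footnote 3 (viscosity normalisation);
A. Friedman, *PDE of Parabolic Type* (1964), Ch. 1 §8 (adjoint equation).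
-/

noncomputable section

open MeasureTheory Set Function Filter TopologicalSpace Metric
open scoped Topology NNReal ENNReal InnerProductSpace Laplacian

namespace Summit.NavierStokesRegularity.NavierStokesRegularity.Theorems

open Literature.Analysis Literature.Analysis.FluidPDE

/-! ### The time dilation on `(−∞, 0)` -/

section Time

/-- The dilation `s ↦ a s`, `a > 0`, preserves `(−∞, 0)`. [folklore] -/
theorem preimage_dilate_Iio {a : ℝ} (ha : 0 < a) :
    (fun r : ℝ => 0 + a * r) ⁻¹' Iio (0 : ℝ) = Iio 0 := by
  ext r
  simp only [mem_preimage, mem_Iio, zero_add]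
  constructor
  · intro h; nlinarith
  · intro h; nlinarith

/-- The dilation tends to `0` from below as `s ↑ 0` (`a > 0`). [folklore] -/
theorem tendsto_dilate_nhdsLT {a : ℝ} (ha : 0 < a) :
    Tendsto (fun s : ℝ => 0 + a * s) (𝓝[<] (0 : ℝ)) (𝓝[<] 0) := by
  have hcont : Continuous fun s : ℝ => 0 + a * s := by fun_prop
  refine tendsto_nhdsWithin_of_tendsto_nhds_of_eventually_within _ ?_ ?_
  · have := (hcont.tendsto 0).mono_left (nhdsWithin_le_nhds (s := Iio (0 : ℝ)))
    simpa using this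
  · filter_upwards [self_mem_nhdsWithin] with s hs
    simp only [mem_Iio, zero_add] at hs ⊢
    nlinarith

end Time

/-! ### Kernel clauses -/

section Kernel

variable {E : Type*} [NormedAddCommGroup E] [InnerProductSpace ℝ E] [FiniteDimensional ℝ E]
  [MeasurableSpace E] [BorelSpace E]

omit [FiniteDimensional ℝ E] [MeasurableSpace E] [BorelSpace E] in
/-- The dilated kernel, unfolded: `stPull a 1 0 0 G s y = G (a s) y`. [folklore] -/
theorem stPull_dilate_apply (a : ℝ) (G : ℝ → E → ℝ) (s : ℝ) (y : E) :
    stPull a 1 0 0 G s y = G (0 + a * s) y := by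
  simp [stPull_apply]

omit [FiniteDimensional ℝ E] [MeasurableSpace E] [BorelSpace E] in
/-- Joint `C²` regularity is preserved by the time dilation. [folklore] -/
theorem contDiffOn_two_uncurry_stPull_dilate {S : Set ℝ} {G : ℝ → E → ℝ}
    (h : ContDiffOn ℝ 2 (uncurry G) (S ×ˢ univ)) (a : ℝ) :
    ContDiffOn ℝ 2 (uncurry (stPull a 1 0 0 G)) (((fun r => 0 + a * r) ⁻¹' S) ×ˢ (univ : Set E)) := by
  have hmaps : MapsTo (stAffine a 1 0 (0 : E)) (((fun r => 0 + a * r) ⁻¹' S) ×ˢ (univ : Set E))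
      (S ×ˢ univ) := fun z hz => mk_mem_prod (by simpa [stAffine_apply] using hz.1) (mem_univ _)
  exact h.comp (contDiff_stAffine a 1 0 (0 : E)).contDiffOn hmaps

/-- **The five kernel clauses under the time dilation `u_a = a u(a ·, ·)`, `G_a = G(a ·, ·)`.**
If `G` is a flow-adapted backward kernel of `∂ₜ + u·∇ − νΔ` on `S` with pole `(T, x₀)`, then `G_a`
is a flow-adapted backward kernel of `∂ₜ + u_a·∇ − (aν)Δ` on the dilated time set with pole
`(a⁻¹ T, x₀)`: every term of the adjoint equation acquires the factor `a`. [folklore] -/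
theorem isAdaptedBackwardKernel_dilate {ν : ℝ} {u : ℝ → E → E} {S : Set ℝ} {T : ℝ} {x₀ : E}
    {G : ℝ → E → ℝ} (hG : IsAdaptedBackwardKernel ν u S T x₀ G) {a : ℝ} (ha : 0 < a) :
    IsAdaptedBackwardKernel (a * ν) (a • stPull a 1 0 0 u) ((fun r => 0 + a * r) ⁻¹' S) (a⁻¹ * T) x₀
      (stPull a 1 0 0 G) where
  contDiffOn := contDiffOn_two_uncurry_stPull_dilate hG.contDiffOn a
  pos s hs y := by rw [stPull_dilate_apply]; exact hG.pos _ hs _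
  adjoint_eq s hs y := by
    have ha0 : (a : ℝ) ≠ 0 := ha.ne'
    have ht : 0 + a * s ∈ S := hs
    have hG2 : ContDiff ℝ 2 (G (0 + a * s)) := hG.contDiff_slice ht
    have e0 : stPull a 1 0 (0 : E) G = (1 : ℝ) • stPull a 1 0 (0 : E) G := (one_smul _ _).symm
    have htime : timeDerivWithin ((fun r => 0 + a * r) ⁻¹' S) (stPull a 1 0 (0 : E) G) s y =
        a * timeDerivWithin S G (0 + a * s) ((0 : E) + (1 : ℝ) • y) := by
      rw [e0, timeDerivWithin_smul_stPull S G 1 ha0 1 0 (0 : E) s y, smul_eq_mul, one_mul]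
    have hdrift : fderiv ℝ (stPull a 1 0 (0 : E) G s) y ((a • stPull a 1 0 0 u) s y) =
        a * fderiv ℝ (G (0 + a * s)) ((0 : E) + (1 : ℝ) • y) (u (0 + a * s) ((0 : E) + (1 : ℝ) • y)) := by
      rw [fderiv_stPull]
      simp only [one_smul, Pi.smul_apply, stPull_apply, map_smul, smul_eq_mul]
    have hlap : (Δ (stPull a 1 0 (0 : E) G s)) y = (Δ (G (0 + a * s))) ((0 : E) + (1 : ℝ) • y) := by
      rw [laplacian_stPull a 1 0 (0 : E) G s y hG2, one_pow, one_smul]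
    rw [htime, hdrift, hlap]
    have key := hG.adjoint_eq (0 + a * s) ht ((0 : E) + (1 : ℝ) • y)
    have : a * (timeDerivWithin S G (0 + a * s) (0 + (1 : ℝ) • y) +
        fderiv ℝ (G (0 + a * s)) (0 + (1 : ℝ) • y) (u (0 + a * s) (0 + (1 : ℝ) • y)) +
        ν * (Δ (G (0 + a * s))) (0 + (1 : ℝ) • y)) = 0 := by rw [key, mul_zero]
    linear_combination this
  integral_eq_one s hs := by
    have ht : 0 + a * s ∈ S := hs
    have h1 : (fun y => stPull a 1 0 (0 : E) G s y) = G (0 + a * s) := by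
      funext y; simp [stPull_apply]
    rw [h1, hG.integral_eq_one _ ht]
  tendsto_integral_mul φ hφ hφb := by
    have hlim := hG.tendsto_integral_mul φ hφ hφb
    have h1 : (fun s => ∫ y, φ y * stPull a 1 0 (0 : E) G s y) =
        (fun t => ∫ x, φ x * G t x) ∘ fun s => 0 + a * s := by
      funext s; simp [stPull_apply]
    rw [h1]
    refine hlim.comp ?_
    -- `s ↦ a s` tends to `T` from below as `s ↑ a⁻¹ T`
    have hcont : Continuous fun s : ℝ => 0 + a * s := by fun_prop
    refine tendsto_nhdsWithin_of_tendsto_nhds_of_eventually_within _ ?_ ?_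
    · have := (hcont.tendsto (a⁻¹ * T)).mono_left (nhdsWithin_le_nhds (s := Iio (a⁻¹ * T)))
      simpa [ha.ne'] using this
    · filter_upwards [self_mem_nhdsWithin] with s hs
      simp only [mem_Iio, zero_add] at hs ⊢
      have : a * s < a * (a⁻¹ * T) := mul_lt_mul_of_pos_left hs ha
      rwa [← mul_assoc, mul_inv_cancel₀ ha.ne', one_mul] at this

/-- The time dilation of an ancient adapted kernel with pole `(0, x₀)` is an ancient adapted
kernel with pole `(0, x₀)`, viscosity `ν ↦ a ν`. [folklore] -/
theorem isAdaptedBackwardKernel_dilate_Iio {ν : ℝ} {u : ℝ → E → E} {x₀ : E} {G : ℝ → E → ℝ}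
    (hG : IsAdaptedBackwardKernel ν u (Iio 0) 0 x₀ G) {a : ℝ} (ha : 0 < a) :
    IsAdaptedBackwardKernel (a * ν) (a • stPull a 1 0 0 u) (Iio 0) 0 x₀ (stPull a 1 0 0 G) := by
  have h := isAdaptedBackwardKernel_dilate hG ha
  rwa [preimage_dilate_Iio ha, mul_zero] at h

/-! ### Gaussian bounds -/

omit [FiniteDimensional ℝ E] [MeasurableSpace E] [BorelSpace E] in
/-- The Gaussian profile under the time dilation: for `a > 0`, `0 ≤ b`,
`K (a b)^{-n/2} exp(−r/(k (a b))) = (K a^{-n/2}) b^{-n/2} exp(−r/((k a) b))`. [folklore] -/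
theorem gaussianProfile_dilate {a : ℝ} (ha : 0 < a) (K k r : ℝ) {b : ℝ} (hb : 0 ≤ b) :
    K * (a * b) ^ (-(Module.finrank ℝ E : ℝ) / 2) * Real.exp (-r / (k * (a * b))) =
      (K * a ^ (-(Module.finrank ℝ E : ℝ) / 2)) * b ^ (-(Module.finrank ℝ E : ℝ) / 2) *
        Real.exp (-r / ((k * a) * b)) := by
  rw [Real.mul_rpow ha.le hb, show k * (a * b) = (k * a) * b by ring]; ring

omit [FiniteDimensional ℝ E] [MeasurableSpace E] [BorelSpace E] in
/-- **Pointwise Gaussian bounds about `(0, x₀)` under the time dilation**: bounds for `G` at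
`(a s, y)` with constants `(c₁, c₂, C₁, C₂)` (`s ≤ 0`) become bounds for `G_a` at `(s, y)` with
constants `(c₁ a^{-n/2}, c₂ a, C₁ a^{-n/2}, C₂ a)`. [folklore] -/
theorem gaussian_bounds_dilate {G : ℝ → E → ℝ} {x₀ : E} {c₁ c₂ C₁ C₂ : ℝ} {a : ℝ} (ha : 0 < a)
    {s : ℝ} (hs : s ≤ 0) (y : E)
    (h : c₁ * ((0 : ℝ) - (0 + a * s)) ^ (-(Module.finrank ℝ E : ℝ) / 2) *
          Real.exp (-(‖y - x₀‖ ^ 2) / (c₂ * ((0 : ℝ) - (0 + a * s)))) ≤ G (0 + a * s) y ∧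
      G (0 + a * s) y ≤ C₁ * ((0 : ℝ) - (0 + a * s)) ^ (-(Module.finrank ℝ E : ℝ) / 2) *
          Real.exp (-(‖y - x₀‖ ^ 2) / (C₂ * ((0 : ℝ) - (0 + a * s))))) :
    (c₁ * a ^ (-(Module.finrank ℝ E : ℝ) / 2)) * ((0 : ℝ) - s) ^ (-(Module.finrank ℝ E : ℝ) / 2) *
          Real.exp (-(‖y - x₀‖ ^ 2) / ((c₂ * a) * ((0 : ℝ) - s))) ≤ stPull a 1 0 0 G s y ∧
      stPull a 1 0 0 G s y ≤
        (C₁ * a ^ (-(Module.finrank ℝ E : ℝ) / 2)) * ((0 : ℝ) - s) ^ (-(Module.finrank ℝ E : ℝ) / 2) *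
          Real.exp (-(‖y - x₀‖ ^ 2) / ((C₂ * a) * ((0 : ℝ) - s))) := by
  have hb : (0 : ℝ) ≤ 0 - s := by linarith
  have e : (0 : ℝ) - (0 + a * s) = a * (0 - s) := by ring
  rw [e] at h
  rw [stPull_dilate_apply, ← gaussianProfile_dilate ha c₁ c₂ _ hb, ← gaussianProfile_dilate ha C₁ C₂ _ hb]
  exact h

omit [FiniteDimensional ℝ E] [MeasurableSpace E] [BorelSpace E] in
/-- The windowed form on `(−∞, 0)`: uniform Gaussian bounds for `G` about `(0, x₀)` on `t < 0` give
uniform Gaussian bounds for `G_a` on `s < 0` (constants `(c₁ a^{-n/2}, c₂ a, C₁ a^{-n/2}, C₂ a)`).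
[folklore] -/
theorem gaussian_bounds_dilate_Iio {G : ℝ → E → ℝ} {x₀ : E} {c₁ c₂ C₁ C₂ : ℝ} {a : ℝ} (ha : 0 < a)
    (h : ∀ t ∈ Iio (0 : ℝ), ∀ y, c₁ * ((0 : ℝ) - t) ^ (-(Module.finrank ℝ E : ℝ) / 2) *
          Real.exp (-(‖y - x₀‖ ^ 2) / (c₂ * ((0 : ℝ) - t))) ≤ G t y ∧
      G t y ≤ C₁ * ((0 : ℝ) - t) ^ (-(Module.finrank ℝ E : ℝ) / 2) *
          Real.exp (-(‖y - x₀‖ ^ 2) / (C₂ * ((0 : ℝ) - t)))) :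
    ∀ s ∈ Iio (0 : ℝ), ∀ y,
      (c₁ * a ^ (-(Module.finrank ℝ E : ℝ) / 2)) * ((0 : ℝ) - s) ^ (-(Module.finrank ℝ E : ℝ) / 2) *
          Real.exp (-(‖y - x₀‖ ^ 2) / ((c₂ * a) * ((0 : ℝ) - s))) ≤ stPull a 1 0 0 G s y ∧
      stPull a 1 0 0 G s y ≤
        (C₁ * a ^ (-(Module.finrank ℝ E : ℝ) / 2)) * ((0 : ℝ) - s) ^ (-(Module.finrank ℝ E : ℝ) / 2) *
          Real.exp (-(‖y - x₀‖ ^ 2) / ((C₂ * a) * ((0 : ℝ) - s))) := by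
  intro s hs y
  have hs' : 0 + a * s ∈ Iio (0 : ℝ) := by
    simp only [mem_Iio, zero_add] at hs ⊢; nlinarith
  exact gaussian_bounds_dilate ha (le_of_lt hs) y (h _ hs' y)

end Kernel

/-! ### Adapted enstrophy and frequency (`ℝ³`), pole time `0` -/

section Frequency

/-- **Adapted enstrophy under the time dilation**: `H_a(s) = a² H(a s)` (`curl u_a = a curl u`,
same kernel values, no Jacobian). [folklore] -/
theorem adaptedEnstrophy_dilate (u : ℝ → EuclideanSpace ℝ (Fin 3) → EuclideanSpace ℝ (Fin 3))
    (G : ℝ → EuclideanSpace ℝ (Fin 3) → ℝ) (a s : ℝ) :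
    adaptedEnstrophy (a • stPull a 1 0 0 u) (stPull a 1 0 0 G) s =
      a ^ 2 * adaptedEnstrophy u G (0 + a * s) := by
  rw [adaptedEnstrophy_apply, adaptedEnstrophy_apply, ← integral_const_mul]
  refine integral_congr_ae (Eventually.of_forall fun y => ?_)
  show ‖curl ((a • stPull a 1 0 0 u) s) y‖ ^ 2 * stPull a 1 0 0 G s y =
    a ^ 2 * (‖curl (u (0 + a * s)) y‖ ^ 2 * G (0 + a * s) y)
  rw [curl_smul_stPull, stPull_apply, norm_smul, mul_one, Real.norm_eq_abs, mul_pow, sq_abs]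
  simp only [one_smul, zero_add]
  ring

/-- **The adapted frequency about pole time `0` is invariant under the time dilation**:
`Λ_a(s) = Λ(a s)` with `Λ_a = adaptedFrequency u_a G_a 0`, `Λ = adaptedFrequency u G 0` (all junk
cases included). [folklore] -/
theorem adaptedFrequency_dilate (u : ℝ → EuclideanSpace ℝ (Fin 3) → EuclideanSpace ℝ (Fin 3))
    (G : ℝ → EuclideanSpace ℝ (Fin 3) → ℝ) {a : ℝ} (ha : 0 < a) (s : ℝ) :
    adaptedFrequency (a • stPull a 1 0 0 u) (stPull a 1 0 0 G) 0 s =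
      adaptedFrequency u G 0 (0 + a * s) := by
  have hH : adaptedEnstrophy (a • stPull a 1 0 0 u) (stPull a 1 0 0 G) =
      fun s => a ^ 2 * adaptedEnstrophy u G (0 + a * s) :=
    funext fun s => adaptedEnstrophy_dilate u G a s
  have hD : deriv (adaptedEnstrophy (a • stPull a 1 0 0 u) (stPull a 1 0 0 G)) s =
      a ^ 2 * (a * deriv (adaptedEnstrophy u G) (0 + a * s)) := by
    rw [hH, deriv_const_mul_field]
    set H := adaptedEnstrophy u G
    have h1 : (fun s => H (0 + a * s)) = ((fun r => H (0 + r)) <| a * ·) := rfl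
    rw [h1, deriv_comp_mul_left a (fun r => H (0 + r)) s, smul_eq_mul,
      deriv_comp_const_add (f := H) (a := 0) (x := a * s)]
  rw [adaptedFrequency_apply, adaptedFrequency_apply, hD, adaptedEnstrophy_dilate]
  set H := adaptedEnstrophy u G (0 + a * s)
  set H' := deriv (adaptedEnstrophy u G) (0 + a * s)
  have ha2 : (a ^ 2 : ℝ) ≠ 0 := by positivity
  rw [show (0 - s) * (a ^ 2 * (a * H')) = ((0 - (0 + a * s)) * H') * a ^ 2 by ring,
    show a ^ 2 * H = H * a ^ 2 by ring, mul_div_mul_right _ _ ha2]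

/-- Positivity of the adapted enstrophy on `(−∞, 0)` is preserved by the time dilation
(`a > 0`). [folklore] -/
theorem adaptedEnstrophy_dilate_pos {u : ℝ → EuclideanSpace ℝ (Fin 3) → EuclideanSpace ℝ (Fin 3)}
    {G : ℝ → EuclideanSpace ℝ (Fin 3) → ℝ} (h : ∀ t ∈ Iio (0 : ℝ), 0 < adaptedEnstrophy u G t)
    {a : ℝ} (ha : 0 < a) :
    ∀ s ∈ Iio (0 : ℝ), 0 < adaptedEnstrophy (a • stPull a 1 0 0 u) (stPull a 1 0 0 G) s := by
  intro s hs
  rw [adaptedEnstrophy_dilate]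
  have hs' : 0 + a * s ∈ Iio (0 : ℝ) := by
    simp only [mem_Iio, zero_add] at hs ⊢; nlinarith
  exact mul_pos (by positivity) (h _ hs')

/-- Constancy of the adapted frequency (pole time `0`) on `(−∞, 0)` is preserved by the time
dilation. [folklore] -/
theorem adaptedFrequency_dilate_const {u : ℝ → EuclideanSpace ℝ (Fin 3) → EuclideanSpace ℝ (Fin 3)}
    {G : ℝ → EuclideanSpace ℝ (Fin 3) → ℝ} {Λ₀ : ℝ} (h : ∀ t ∈ Iio (0 : ℝ), adaptedFrequency u G 0 t = Λ₀)
    {a : ℝ} (ha : 0 < a) :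
    ∀ s ∈ Iio (0 : ℝ), adaptedFrequency (a • stPull a 1 0 0 u) (stPull a 1 0 0 G) 0 s = Λ₀ := by
  intro s hs
  rw [adaptedFrequency_dilate u G ha]
  have hs' : 0 + a * s ∈ Iio (0 : ℝ) := by
    simp only [mem_Iio, zero_add] at hs ⊢; nlinarith
  exact h _ hs'

end Frequency

/-! ### Solution clauses on `(−∞, 0)` -/

section Solution

variable {u : ℝ → EuclideanSpace ℝ (Fin 3) → EuclideanSpace ℝ (Fin 3)}
  {p : ℝ → EuclideanSpace ℝ (Fin 3) → ℝ}

/-- Ancient classical solutions with viscosity `ν` dilate to ancient classical solutions with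
viscosity `a ν` (pressure `a² p(a s, ·)`; the tree's `IsClassicalNSSolutionOn.stRescale`).
[folklore] -/
theorem isClassicalNSSolutionOn_dilate_Iio {ν : ℝ} (h : IsClassicalNSSolutionOn (Iio 0) ν 0 u p)
    {a : ℝ} (ha : 0 < a) :
    IsClassicalNSSolutionOn (Iio 0) (a * ν) 0 (a • stPull a 1 0 0 u) (a ^ 2 • stPull a 1 0 0 p) := by
  have key := h.stRescale ha one_pos (by rw [mul_one]) 0 (0 : EuclideanSpace ℝ (Fin 3))
  rw [smul_stPull_zero, preimage_dilate_Iio ha, div_one] at key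
  exact key

/-- **The Type-I bound under the time dilation**: `‖u‖ ≤ C/√(−t)` on `(−∞, 0)` gives
`‖u_a‖ ≤ (C √a)/√(−s)` on `(−∞, 0)`. [folklore] -/
theorem typeI_bound_dilate {C : ℝ} (h : ∀ t ∈ Iio (0 : ℝ), ∀ x, ‖u t x‖ ≤ C / Real.sqrt (-t))
    {a : ℝ} (ha : 0 < a) :
    ∀ s ∈ Iio (0 : ℝ), ∀ y, ‖(a • stPull a 1 0 0 u) s y‖ ≤ (C * Real.sqrt a) / Real.sqrt (-s) := by
  intro s hs y
  have hs0 : 0 < -s := neg_pos.2 hs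
  have hs' : 0 + a * s ∈ Iio (0 : ℝ) := by
    simp only [mem_Iio, zero_add] at hs ⊢; nlinarith
  have hb := h _ hs' ((0 : EuclideanSpace ℝ (Fin 3)) + (1 : ℝ) • y)
  have hsq : Real.sqrt (-(0 + a * s)) = Real.sqrt a * Real.sqrt (-s) := by
    rw [show -(0 + a * s) = a * (-s) by ring, Real.sqrt_mul ha.le]
  rw [hsq] at hb
  have hC : 0 ≤ C := by
    have h1 := (norm_nonneg _).trans hb
    have h2 : 0 < Real.sqrt a * Real.sqrt (-s) := mul_pos (Real.sqrt_pos.2 ha) (Real.sqrt_pos.2 hs0)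
    by_contra hC; push Not at hC
    have : C / (Real.sqrt a * Real.sqrt (-s)) < 0 := div_neg_of_neg_of_pos hC h2
    linarith
  simp only [Pi.smul_apply, stPull_apply, norm_smul, Real.norm_eq_abs, abs_of_pos ha]
  have hsa : 0 < Real.sqrt a := Real.sqrt_pos.2 ha
  have hss : 0 < Real.sqrt (-s) := Real.sqrt_pos.2 hs0
  calc a * ‖u (0 + a * s) (0 + (1 : ℝ) • y)‖ ≤ a * (C / (Real.sqrt a * Real.sqrt (-s))) :=
        mul_le_mul_of_nonneg_left hb ha.le
    _ = (C * Real.sqrt a) / Real.sqrt (-s) := by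
        have haa : (Real.sqrt a) ^ 2 = a := Real.sq_sqrt ha.le
        field_simp
        nlinarith [haa]

end Solution

end Summit.NavierStokesRegularity.NavierStokesRegularity.Theorems

end
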